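import Summits.NavierStokesRegularity.NavierStokesRegularity.Theorems.QuarterLogPincerLogCubeSharpLFourTools
import Literature.Analysis.FunctionSpaces.MinkowskiIntegral
import Literature.Analysis.FluidPDE.ForcedOseenRepresentationClassical
import Literature.Analysis.FluidPDE.NSCriticalClosureTao
import Literature.Analysis.FluidPDE.TaoLocalisation
import Summits.NavierStokesRegularity.NavierStokesRegularity.Theorems.TypeICertificateLadderRungReynoldsOneTaoCover
import HarnessLib

/-!
# `QuarterLogPincer.LogCubeSharp` (item stmt-NavierStokesRegularity-23935), rung 1: under the
# quarter-rate enstrophy law the `L⁴` norm grows at most like `(T−t)^{-1/8}`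

Helper file (`--supports stmt-NavierStokesRegularity-23935`) of the crux `LogCubeSharp` of route
`QuarterLogPincer` (sharp logarithmic cube ceiling `‖u(t)‖₃³ ≤ C₁ + C₂ log(T/(T−t))` under the
quarter law `∫|curl u(t)|² ≤ K/√(T−t)` and the velocity Type-I rate). This file is RUNG 1 of the
planner's two-rung ladder (line card `LogCubeSharp_line.md`): the template-sharp `L⁴` bound

  `‖u(t)‖_{L⁴} ≤ W₁ + W₂ (T−t)^{-1/8}`, i.e. `‖u(t)‖₄² ≲ (T−t)^{-1/4}`  (`exists_eLpNorm_four_le`),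

by the TYPE-I-FREE, PRESSURE-FREE Oseen road (the Duhamel road of the landed
`LogCubeCeiling.logCubeCeiling_proof`, one Lebesgue exponent up): on every closed sub-slab `[0,t]`
the solution is bounded with finite energy (Tao-class cover, `RungReynoldsOne.stub_taoCover`),
hence `u(s) = e^{νsΔ}u(0) − B^ν_0(u,u)(s)` a.e. (`IsClassicalNSSolutionOn.ae_eq_forced_oseenMild`);
the caloric term contracts `L⁴`; for the bilinear term, Minkowski in time and the OFF-DIAGONAL
slice bound `‖e^{σΔ}P∇·(a⊗b)‖₄ ≤ C σ^{-5/8}‖a‖₆‖b‖₆` (`exists_eLpNorm_four_oseenSlice_le`, the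
tree's interpolated Kato bound with `(p,q) = (3,4)`), with Sobolev against the enstrophy
`‖u(τ)‖₆² ≤ K_S² ∫|curl u(τ)|² ≤ K_S² K/√(T−τ)`, give
`‖B^ν_0(u,u)(s)‖₄ ≤ C ν^{-5/8} K_S² K⁺ ∫₀ˢ (s−τ)^{-5/8}(T−τ)^{-1/2} dτ ≤ (32/3) C ν^{-5/8} K_S² K⁺ (T−s)^{-1/8}`
(`lintegral_kernel_le_rpow_eighth`, tools file `QuarterLogPincerLogCubeSharpLFourTools.lean`). The exponent `−1/8` is
the template rate of a `|y|⁻¹`-tailed Type-I profile (`‖u(t)‖₄⁴ ≍ (T−t)^{-1/2}`), the input the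
`L³` energy identity of rung 2 needs for its pressure term (`‖p‖₂ ≲ ‖u‖₄²`).

HONEST FRAMING: a conditional a-priori estimate for a GIVEN classical solution under a HYPOTHESISED
enstrophy law; the quarter law (`EnstrophyQuarterLaw`, stmt-1574) stays open and the crux
`LogCubeSharp` is NOT closed by this file. Navier–Stokes regularity is NOT proved here, nor
claimed. References: Kato 1984 §2 (2.3)–(2.5); Lemarié-Rieusset 2016 Thm. 7.5. [folklore]
-/

noncomputable section

open Set Filter Topology MeasureTheory Function
open scoped ENNReal NNReal
open Literature.Analysis Literature.Analysis.FluidPDE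

namespace Summit.NavierStokesRegularity.NavierStokesRegularity.Theorems

-- the problem directory repeats the summit name (`NavierStokesRegularity/NavierStokesRegularity`)
set_option linter.dupNamespace false

namespace LogCubeSharp

/-! ### The `L⁴` slab estimate -/

/-- **The `L⁴` Duhamel estimate on a closed slab** (rung 1 of the `LogCubeSharp` ladder, by the
Type-I-free, pressure-free Oseen road). Let `(u,p)` be a classical solution of the unforced system
(`ν > 0`) on `[0,S] × ℝ³`, bounded by `M` with finite energy, and suppose the quarter-rate law
`∫|curl u(τ)|² ≤ K/√(T−τ)` on `[0,S]`, `S < T`. Let `C` be a constant of the `L⁴` bound of the Oseen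
slice operator (`‖e^{σΔ}P∇·(a⊗b)‖₄ ≤ C σ^{-5/8} ‖a‖₆ ‖b‖₆`). Then for every `s ∈ (0,S]`,
`‖u(s)‖₄ ≤ ‖u(0)‖₄ + C ν^{-5/8} K_S² max(K,0) · (32/3) (T−s)^{-1/8}`
(Oseen representation `u(s) = e^{νsΔ}u(0) − B^ν_0(u,u)(s)`, `L⁴` contraction of the heat flow,
Minkowski in time, the slice bound, Sobolev against the enstrophy and
`lintegral_kernel_le_rpow_eighth`). The rate `(T−s)^{-1/8}` is the template rate of a
`|y|⁻¹`-tailed profile (`‖u(t)‖₄⁴ ≍ (T−t)^{-1/2}`).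
[cite: Kato1984, §2 (2.3)] [cite: LemarieRieusset2016, Thm. 6.1 (6.12) and Thm. 7.5] -/
theorem slab_four {ν T S K M C : ℝ} (hν : 0 < ν) (hS : 0 < S) (hST : S < T)
    {u : ℝ → EuclideanSpace ℝ (Fin 3) → EuclideanSpace ℝ (Fin 3)}
    {p : ℝ → EuclideanSpace ℝ (Fin 3) → ℝ} (hcl : IsClassicalNSSolutionOn (Icc 0 S) ν 0 u p)
    (hE : ∃ C' : ℝ≥0∞, C' < ⊤ ∧ ∀ t ∈ Icc 0 S, ∫⁻ x, ‖u t x‖ₑ ^ 2 ≤ C')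
    (hM : 0 < M) (hMb : ∀ t ∈ Icc 0 S, ∀ y, ‖u t y‖ ≤ M)
    (hquarter : ∀ t ∈ Icc 0 S,
      ∫⁻ x, ‖curl (u t) x‖ₑ ^ 2 ≤ ENNReal.ofReal (K / Real.sqrt (T - t)))
    (hC0 : 0 ≤ C)
    (hC : ∀ {σ : ℝ}, 0 < σ →
      ∀ {a b : EuclideanSpace ℝ (Fin 3) → EuclideanSpace ℝ (Fin 3)}, AEStronglyMeasurable a volume →
      AEStronglyMeasurable b volume →
        eLpNorm (fun x => ∫ y, oseenKernel σ (x - y) (a y) (b y)) 4 volume ≤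
          ENNReal.ofReal (C * σ ^ (-(5 / 8 : ℝ))) * (eLpNorm a 6 volume * eLpNorm b 6 volume))
    (hKdr : ∀ {s : ℝ}, 0 < s → s < T →
      ∫⁻ τ in Ioo 0 s, ENNReal.ofReal ((s - τ) ^ (-(5 / 8 : ℝ))) *
          ENNReal.ofReal ((T - τ) ^ (-(1 / 2 : ℝ))) ≤
        ENNReal.ofReal (32 / 3 * (T - s) ^ (-(1 / 8 : ℝ))))
    {s : ℝ} (hs : s ∈ Ioc 0 S) :
    eLpNorm (u s) 4 volume ≤ eLpNorm (u 0) 4 volume +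
      ENNReal.ofReal (C * ν ^ (-(5 / 8 : ℝ)) *
        (SNormLESNormFDerivOfEqConst (EuclideanSpace ℝ (Fin 3))
          (volume : Measure (EuclideanSpace ℝ (Fin 3))) 2 : ℝ) ^ 2 * max K 0 *
          (32 / 3 * (T - s) ^ (-(1 / 8 : ℝ)))) := by
  set KSr : ℝ := (SNormLESNormFDerivOfEqConst (EuclideanSpace ℝ (Fin 3))
    (volume : Measure (EuclideanSpace ℝ (Fin 3))) 2 : ℝ) with hKSr
  have hKSr0 : 0 ≤ KSr := NNReal.coe_nonneg _
  set A : ℝ := C * ν ^ (-(5 / 8 : ℝ)) * KSr ^ 2 * max K 0 with hA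
  have hK0 : 0 ≤ max K 0 := le_max_right _ _
  have hν58 : 0 ≤ ν ^ (-(5 / 8 : ℝ)) := Real.rpow_nonneg hν.le _
  have hA0 : 0 ≤ A := by positivity
  have hs0 : 0 < s := hs.1
  have hsS : s ≤ S := hs.2
  have hsT : s < T := lt_of_le_of_lt hsS hST
  have hνs : 0 < ν * s := mul_pos hν hs0
  have h0I : (0 : ℝ) ∈ Icc 0 S := ⟨le_rfl, hS.le⟩
  have hsI : s ∈ Icc 0 S := ⟨hs0.le, hsS⟩
  have hTs : 0 < T - s := sub_pos.2 hsT
  -- ### the Oseen representation at time `s` (zero force)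
  have hgc : Continuous (uncurry (0 : ℝ → EuclideanSpace ℝ (Fin 3) → EuclideanSpace ℝ (Fin 3))) :=
    continuous_const
  have hG : ∀ τ ∈ Icc 0 S, ∀ y,
      ‖(0 : ℝ → EuclideanSpace ℝ (Fin 3) → EuclideanSpace ℝ (Fin 3)) τ y‖ ≤ 0 := fun τ _ y => by simp
  have hgdiv : ∀ τ ∈ Icc 0 S,
      IsWeaklyDivFree ((0 : ℝ → EuclideanSpace ℝ (Fin 3) → EuclideanSpace ℝ (Fin 3)) τ) :=
    fun τ _ θ _ => by simp
  have hg2 : ∀ τ ∈ Icc 0 S,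
      eLpNorm ((0 : ℝ → EuclideanSpace ℝ (Fin 3) → EuclideanSpace ℝ (Fin 3)) τ) 2 volume ≤
        (0 : ℝ≥0∞) := fun τ _ => by simp
  have hrep := hcl.ae_eq_forced_oseenMild hν hS hgc hG hgdiv ENNReal.zero_ne_top hg2 hE hM hMb hs
  have h0 : ∀ y, forceDuhamel ν 0 (0 : ℝ → EuclideanSpace ℝ (Fin 3) → EuclideanSpace ℝ (Fin 3)) s y = 0 := by
    intro y
    rw [forceDuhamel_apply]
    have hz : ∀ τ, UnboundedOperators.heatExtension
        ((0 : ℝ → EuclideanSpace ℝ (Fin 3) → EuclideanSpace ℝ (Fin 3)) τ) (ν * (s - τ)) y = 0 := by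
      intro τ
      have : ((0 : ℝ → EuclideanSpace ℝ (Fin 3) → EuclideanSpace ℝ (Fin 3)) τ) =
          fun _ : EuclideanSpace ℝ (Fin 3) => (0 : EuclideanSpace ℝ (Fin 3)) := rfl
      rw [this, UnboundedOperators.heatExtension_zero_fun]; rfl
    simp_rw [hz, integral_zero]
  have hrep' : u s =ᵐ[volume] fun x =>
      UnboundedOperators.heatExtension (u 0) (ν * s) x - oseenDuhamel ν 0 u u s x := by
    filter_upwards [hrep] with x hx
    rw [hx, h0 x, add_zero]
  -- ### `u 0 ∈ L⁴` and the caloric term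
  have hu0c : Continuous (u 0) := (hcl.contDiff_velocity h0I).continuous
  have h4top : eLpNorm (u 0) 4 volume < ⊤ := by
    obtain ⟨C', hC', hCb⟩ := hE
    exact eLpNorm_four_lt_top_of_bounded hu0c.aestronglyMeasurable (hMb 0 h0I)
      ((hCb 0 h0I).trans_lt hC')
  have hmem4 : MemLp (u 0) 4 volume := ⟨hu0c.aestronglyMeasurable, h4top⟩
  have hH : eLpNorm (UnboundedOperators.heatExtension (u 0) (ν * s)) 4 volume ≤
      eLpNorm (u 0) 4 volume :=
    UnboundedOperators.eLpNorm_heatExtension_le_holds hmem4 (by norm_num) hνs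
  -- ### the clamped field (globally measurable, `= u` on `[0,S]`)
  set ut : ℝ → EuclideanSpace ℝ (Fin 3) → EuclideanSpace ℝ (Fin 3) :=
    fun τ y => u (Set.projIcc 0 S hS.le τ : ℝ) y with hut
  have hum : Measurable (uncurry ut) := by
    have hcont : ContinuousOn (uncurry u) (Icc 0 S ×ˢ univ) := hcl.smooth_velocity.continuousOn
    have hφ : Continuous fun q : ℝ × EuclideanSpace ℝ (Fin 3) =>
        ((Set.projIcc 0 S hS.le q.1 : ℝ), q.2) :=
      (continuous_subtype_val.comp (continuous_projIcc.comp continuous_fst)).prodMk continuous_snd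
    have hmaps : ∀ q : ℝ × EuclideanSpace ℝ (Fin 3),
        ((Set.projIcc 0 S hS.le q.1 : ℝ), q.2) ∈ Icc 0 S ×ˢ (univ : Set (EuclideanSpace ℝ (Fin 3))) :=
      fun q => ⟨(Set.projIcc 0 S hS.le q.1).2, mem_univ _⟩
    have h : Continuous ((uncurry u) ∘ fun q : ℝ × EuclideanSpace ℝ (Fin 3) =>
        ((Set.projIcc 0 S hS.le q.1 : ℝ), q.2)) :=
      hcont.comp_continuous hφ hmaps
    exact h.measurable
  have hut_eq : ∀ τ ∈ Icc 0 S, ut τ = u τ := fun τ hτ => by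
    funext y
    simp only [hut, Set.projIcc_of_mem hS.le hτ]
  -- ### the slice bound
  have hslice : ∀ τ ∈ Ioo 0 s,
      eLpNorm (fun x => ∫ y, oseenKernel (ν * (s - τ)) (x - y) (ut τ y) (ut τ y)) 4 volume ≤
        ENNReal.ofReal A * (ENNReal.ofReal ((s - τ) ^ (-(5 / 8 : ℝ))) *
          ENNReal.ofReal ((T - τ) ^ (-(1 / 2 : ℝ)))) := by
    intro τ hτ
    have hτI : τ ∈ Icc 0 S := ⟨hτ.1.le, hτ.2.le.trans hsS⟩
    rw [hut_eq τ hτI]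
    have hστ : 0 < s - τ := sub_pos.2 hτ.2
    have hσ : 0 < ν * (s - τ) := mul_pos hν hστ
    have hTτ : 0 < T - τ := by linarith [hτ.2]
    have hcτ : Continuous (u τ) := (hcl.contDiff_velocity hτI).continuous
    have hmeas : AEStronglyMeasurable (u τ) volume := hcτ.aestronglyMeasurable
    have h1 := hC hσ hmeas hmeas
    have hv2 : MemLp (u τ) 2 volume := by
      obtain ⟨C', hC', hCb⟩ := hE
      refine ⟨hmeas, ?_⟩
      rw [eLpNorm_eq_lintegral_rpow_enorm_toReal two_ne_zero ENNReal.ofNat_ne_top, ENNReal.toReal_ofNat]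
      refine ENNReal.rpow_lt_top_of_nonneg (by norm_num) (ne_of_lt ?_)
      refine lt_of_le_of_lt (le_of_eq (lintegral_congr fun x => ?_)) ((hCb τ hτI).trans_lt hC')
      rw [← ENNReal.rpow_natCast]; norm_num
    have h6 := LogCubeCeiling.eLpNorm_six_mul_self_le_curl
      ((hcl.contDiff_velocity hτI).of_le (by norm_cast)) (hcl.divFree τ hτI) hv2
    have hKle : ENNReal.ofReal (K / Real.sqrt (T - τ)) ≤
        ENNReal.ofReal (max K 0 * (T - τ) ^ (-(1 / 2 : ℝ))) := by
      apply ENNReal.ofReal_le_ofReal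
      rw [Real.sqrt_eq_rpow, div_eq_mul_inv, ← Real.rpow_neg hTτ.le]
      exact mul_le_mul_of_nonneg_right (le_max_left _ _) (Real.rpow_nonneg hTτ.le _)
    have hKS2 : (SNormLESNormFDerivOfEqConst (EuclideanSpace ℝ (Fin 3))
        (volume : Measure (EuclideanSpace ℝ (Fin 3))) 2 : ℝ≥0∞) ^ 2 = ENNReal.ofReal (KSr ^ 2) := by
      rw [hKSr, ENNReal.ofReal_pow (NNReal.coe_nonneg _), ENNReal.ofReal_coe_nnreal]
    calc eLpNorm (fun x => ∫ y, oseenKernel (ν * (s - τ)) (x - y) (u τ y) (u τ y)) 4 volume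
        ≤ ENNReal.ofReal (C * (ν * (s - τ)) ^ (-(5 / 8 : ℝ))) *
            (eLpNorm (u τ) 6 volume * eLpNorm (u τ) 6 volume) := h1
      _ ≤ ENNReal.ofReal (C * (ν * (s - τ)) ^ (-(5 / 8 : ℝ))) *
            (ENNReal.ofReal (KSr ^ 2) * ENNReal.ofReal (max K 0 * (T - τ) ^ (-(1 / 2 : ℝ)))) := by
          refine mul_le_mul' le_rfl ?_
          rw [← hKS2]
          exact h6.trans (mul_le_mul' le_rfl ((hquarter τ hτI).trans hKle))
      _ = ENNReal.ofReal A * (ENNReal.ofReal ((s - τ) ^ (-(5 / 8 : ℝ))) *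
            ENNReal.ofReal ((T - τ) ^ (-(1 / 2 : ℝ)))) := by
          have hn1 : 0 ≤ (s - τ) ^ (-(5 / 8 : ℝ)) := Real.rpow_nonneg hστ.le _
          have hn2 : 0 ≤ (T - τ) ^ (-(1 / 2 : ℝ)) := Real.rpow_nonneg hTτ.le _
          rw [Real.mul_rpow hν.le hστ.le, ← ENNReal.ofReal_mul (by positivity),
            ← ENNReal.ofReal_mul (by positivity), ← ENNReal.ofReal_mul hn1,
            ← ENNReal.ofReal_mul hA0]
          congr 1
          rw [hA]
          ring
  -- ### Minkowski in time for the bilinear term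
  have hB : eLpNorm (oseenDuhamel ν 0 u u s) 4 volume ≤
      ENNReal.ofReal (A * (32 / 3 * (T - s) ^ (-(1 / 8 : ℝ)))) := by
    have heq : oseenDuhamel ν 0 u u s =
        fun x => ∫ τ in Ioo 0 s, ∫ y, oseenKernel (ν * (s - τ)) (x - y) (ut τ y) (ut τ y) := by
      funext x
      rw [oseenDuhamel_apply]
      refine setIntegral_congr_fun measurableSet_Ioo fun τ hτ => ?_
      have hτI : τ ∈ Icc 0 S := ⟨hτ.1.le, hτ.2.le.trans hsS⟩
      simp only [hut_eq τ hτI]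
    have hMink := FunctionSpaces.eLpNorm_integral_le_lintegral_eLpNorm
      (μ := (volume : Measure (EuclideanSpace ℝ (Fin 3))))
      (ν := volume.restrict (Ioo 0 s)) (aestronglyMeasurable_oseenIntegrand_swap hum hum ν s _)
      (p := 4) (by norm_num) (by norm_num)
    rw [heq]
    calc eLpNorm (fun x => ∫ τ in Ioo 0 s, ∫ y, oseenKernel (ν * (s - τ)) (x - y) (ut τ y) (ut τ y))
          4 volume
        ≤ ∫⁻ τ in Ioo 0 s,
            eLpNorm (fun x => ∫ y, oseenKernel (ν * (s - τ)) (x - y) (ut τ y) (ut τ y)) 4 volume :=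
          hMink
      _ ≤ ∫⁻ τ in Ioo 0 s, ENNReal.ofReal A * (ENNReal.ofReal ((s - τ) ^ (-(5 / 8 : ℝ))) *
            ENNReal.ofReal ((T - τ) ^ (-(1 / 2 : ℝ)))) :=
          setLIntegral_mono' measurableSet_Ioo fun τ hτ => hslice τ hτ
      _ = ENNReal.ofReal A * ∫⁻ τ in Ioo 0 s, ENNReal.ofReal ((s - τ) ^ (-(5 / 8 : ℝ))) *
            ENNReal.ofReal ((T - τ) ^ (-(1 / 2 : ℝ))) :=
          lintegral_const_mul' _ _ ENNReal.ofReal_ne_top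
      _ ≤ ENNReal.ofReal A * ENNReal.ofReal (32 / 3 * (T - s) ^ (-(1 / 8 : ℝ))) :=
          mul_le_mul' le_rfl (hKdr hs0 hsT)
      _ = ENNReal.ofReal (A * (32 / 3 * (T - s) ^ (-(1 / 8 : ℝ)))) :=
          (ENNReal.ofReal_mul hA0).symm
  -- ### measurability of the pieces and assembly
  have hHm : AEStronglyMeasurable (UnboundedOperators.heatExtension (u 0) (ν * s)) volume :=
    (UnboundedOperators.contDiff_heatExtension_holds hmem4 (by norm_num) hνs).continuous.aestronglyMeasurable
  have hum_s : AEStronglyMeasurable (u s) volume :=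
    (hcl.contDiff_velocity hsI).continuous.aestronglyMeasurable
  have hBm : AEStronglyMeasurable (oseenDuhamel ν 0 u u s) volume := by
    have hae : oseenDuhamel ν 0 u u s =ᵐ[volume] fun x =>
        UnboundedOperators.heatExtension (u 0) (ν * s) x - u s x := by
      filter_upwards [hrep'] with x hx
      rw [hx]
      abel
    exact (hHm.sub hum_s).congr hae.symm
  calc eLpNorm (u s) 4 volume
      = eLpNorm (fun x => UnboundedOperators.heatExtension (u 0) (ν * s) x -
          oseenDuhamel ν 0 u u s x) 4 volume := eLpNorm_congr_ae hrep'
    _ ≤ eLpNorm (UnboundedOperators.heatExtension (u 0) (ν * s)) 4 volume +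
          eLpNorm (oseenDuhamel ν 0 u u s) 4 volume := eLpNorm_sub_le hHm hBm (by norm_num)
    _ ≤ eLpNorm (u 0) 4 volume +
          ENNReal.ofReal (A * (32 / 3 * (T - s) ^ (-(1 / 8 : ℝ)))) := add_le_add hH hB

/-! ### The route frame -/

/-- **Rung 1 of the `LogCubeSharp` ladder in the route frame: the template-sharp `L⁴` bound.**
For a classical solution of the unforced Navier–Stokes system on `ℝ³ × [0,T)` (`ν, T > 0`),
Leray–Hopf from its rapidly decaying datum, with the quarter-rate enstrophy law
`∫|curl u(t)|² ≤ K/√(T−t)` on `[0,T)`, there are `W₁, W₂ ≥ 0` with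
`‖u(t)‖_{L⁴} ≤ W₁ + W₂ (T−t)^{-1/8}` for all `t ∈ [0,T)` — i.e. `‖u(t)‖₄² ≲ (T−t)^{-1/4}`, the
rate of a `|y|⁻¹`-tailed blow-up profile. Proof: Tao-class cover of each closed sub-slab `[0,t]`
(boundedness, finite energy) and `slab_four`; `W₁ = ‖u(0)‖₄`,
`W₂ = (32/3) C ν^{-5/8} K_S² max(K,0)`. The velocity Type-I rate is NOT used. NOT a regularity
claim: the quarter law is a hypothesis. [folklore] -/
theorem exists_eLpNorm_four_le {ν T : ℝ} (hν : 0 < ν) (hT : 0 < T)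
    {u : ℝ → EuclideanSpace ℝ (Fin 3) → EuclideanSpace ℝ (Fin 3)}
    {p : ℝ → EuclideanSpace ℝ (Fin 3) → ℝ} (hcl : IsClassicalNSSolutionOn (Ico 0 T) ν 0 u p)
    (hLH : IsLerayHopfOn T ν 0 (u 0) u) (hdec : HasRapidSpatialDecay (u 0)) {K : ℝ}
    (hK : ∀ t ∈ Ico 0 T, ∫⁻ x, ‖curl (u t) x‖ₑ ^ 2 ≤ ENNReal.ofReal (K / Real.sqrt (T - t))) :
    ∃ W₁ W₂ : ℝ, 0 ≤ W₁ ∧ 0 ≤ W₂ ∧ eLpNorm (u 0) 4 volume = ENNReal.ofReal W₁ ∧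
      ∀ t ∈ Ico 0 T, eLpNorm (u t) 4 volume ≤
        ENNReal.ofReal (W₁ + W₂ * (T - t) ^ (-(1 / 8 : ℝ))) := by
  obtain ⟨C, hC0, hC⟩ := exists_eLpNorm_four_oseenSlice_le
  set KSr : ℝ := (SNormLESNormFDerivOfEqConst (EuclideanSpace ℝ (Fin 3))
    (volume : Measure (EuclideanSpace ℝ (Fin 3))) 2 : ℝ) with hKSr
  set A : ℝ := C * ν ^ (-(5 / 8 : ℝ)) * KSr ^ 2 * max K 0 with hA
  have hK0 : 0 ≤ max K 0 := le_max_right _ _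
  have hKSr0 : 0 ≤ KSr := NNReal.coe_nonneg _
  have hν58 : 0 ≤ ν ^ (-(5 / 8 : ℝ)) := Real.rpow_nonneg hν.le _
  have hA0 : 0 ≤ A := by positivity
  -- `u 0 ∈ L⁴` (Tao-class cover of `[0, T/2]`: bounded with finite energy)
  obtain ⟨q₀, hcl₀, hu₀, -, -⟩ := RungReynoldsOne.stub_taoCover hν hT hcl hLH hdec (T' := T / 2)
    ⟨by positivity, by linarith⟩
  obtain ⟨B₀, -, hB₀⟩ := exists_forall_norm_le_of_hasBoundedSobolevNormsOn hcl₀ hu₀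
  have hE0 : ∫⁻ x, ‖u 0 x‖ₑ ^ 2 < ⊤ :=
    (hLH.lintegral_enorm_sq_le hν.le ⟨le_rfl, hT.le⟩).trans_lt ENNReal.ofReal_lt_top
  have h4top : eLpNorm (u 0) 4 volume < ⊤ :=
    eLpNorm_four_lt_top_of_bounded
      (hcl.contDiff_velocity ⟨le_rfl, hT⟩).continuous.aestronglyMeasurable
      (hB₀ 0 ⟨le_rfl, by positivity⟩) hE0
  set a : ℝ := (eLpNorm (u 0) 4 volume).toReal with ha
  have ha0 : 0 ≤ a := ENNReal.toReal_nonneg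
  have ha4 : eLpNorm (u 0) 4 volume = ENNReal.ofReal a := (ENNReal.ofReal_toReal h4top.ne).symm
  refine ⟨a, A * (32 / 3), ha0, by positivity, ha4, fun t ht => ?_⟩
  have hTt : 0 < T - t := sub_pos.2 ht.2
  have hR0 : 0 ≤ (T - t) ^ (-(1 / 8 : ℝ)) := Real.rpow_nonneg hTt.le _
  rcases eq_or_lt_of_le ht.1 with h0 | ht0
  · -- `t = 0`
    rw [← h0, ha4]
    refine ENNReal.ofReal_le_ofReal ?_
    have : 0 ≤ A * (32 / 3) * (T - 0) ^ (-(1 / 8 : ℝ)) := by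
      rw [sub_zero]; positivity
    linarith
  · -- `0 < t < T`: the slab `[0, t]`
    obtain ⟨q, hclq, huq, -, -⟩ := RungReynoldsOne.stub_taoCover hν hT hcl hLH hdec (T' := t) ⟨ht0, ht.2⟩
    obtain ⟨B, -, hB⟩ := exists_forall_norm_le_of_hasBoundedSobolevNormsOn hclq huq
    have hE : ∃ C' : ℝ≥0∞, C' < ⊤ ∧ ∀ τ ∈ Icc 0 t, ∫⁻ x, ‖u τ x‖ₑ ^ 2 ≤ C' :=
      ⟨ENNReal.ofReal (2 * VectorCalculus.kineticEnergy (u 0)), ENNReal.ofReal_lt_top,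
        fun τ hτ => hLH.lintegral_enorm_sq_le hν.le ⟨hτ.1, hτ.2.trans ht.2.le⟩⟩
    have hMb : ∀ τ ∈ Icc 0 t, ∀ y, ‖u τ y‖ ≤ max B 1 := fun τ hτ y =>
      (hB τ hτ y).trans (le_max_left _ _)
    have hquarter : ∀ τ ∈ Icc 0 t,
        ∫⁻ x, ‖curl (u τ) x‖ₑ ^ 2 ≤ ENNReal.ofReal (K / Real.sqrt (T - τ)) :=
      fun τ hτ => hK τ ⟨hτ.1, hτ.2.trans_lt ht.2⟩
    have h := slab_four hν ht0 ht.2 hclq hE (lt_max_of_lt_right one_pos) hMb hquarter hC0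
      (fun hσ _ _ ha hb => hC hσ ha hb) (fun hs hsT => lintegral_kernel_le_rpow_eighth hs hsT)
      ⟨ht0, le_rfl⟩
    rw [ha4, ← ENNReal.ofReal_add ha0 (by positivity)] at h
    refine h.trans (le_of_eq ?_)
    congr 1
    rw [hA]
    ring

/-- **Rung 1, squared form**: `‖u(t)‖₄² ≤ 2W₁² + 2W₂² (T−t)^{-1/4}` on `[0,T)` (the input of the
`L³` energy identity of rung 2, where it bounds the pressure: `‖p‖₂ ≲ ‖u‖₄²`). [folklore] -/
theorem exists_eLpNorm_four_sq_le {ν T : ℝ} (hν : 0 < ν) (hT : 0 < T)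
    {u : ℝ → EuclideanSpace ℝ (Fin 3) → EuclideanSpace ℝ (Fin 3)}
    {p : ℝ → EuclideanSpace ℝ (Fin 3) → ℝ} (hcl : IsClassicalNSSolutionOn (Ico 0 T) ν 0 u p)
    (hLH : IsLerayHopfOn T ν 0 (u 0) u) (hdec : HasRapidSpatialDecay (u 0)) {K : ℝ}
    (hK : ∀ t ∈ Ico 0 T, ∫⁻ x, ‖curl (u t) x‖ₑ ^ 2 ≤ ENNReal.ofReal (K / Real.sqrt (T - t))) :
    ∃ V₁ V₂ : ℝ, 0 ≤ V₁ ∧ 0 ≤ V₂ ∧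
      ∀ t ∈ Ico 0 T, eLpNorm (u t) 4 volume ^ 2 ≤
        ENNReal.ofReal (V₁ + V₂ * (T - t) ^ (-(1 / 4 : ℝ))) := by
  obtain ⟨W₁, W₂, hW₁, hW₂, -, hW⟩ := exists_eLpNorm_four_le hν hT hcl hLH hdec hK
  refine ⟨2 * W₁ ^ 2, 2 * W₂ ^ 2, by positivity, by positivity, fun t ht => ?_⟩
  have hTt : 0 < T - t := sub_pos.2 ht.2
  set r : ℝ := (T - t) ^ (-(1 / 8 : ℝ)) with hr
  have hr0 : 0 ≤ r := Real.rpow_nonneg hTt.le _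
  have hr2 : r ^ 2 = (T - t) ^ (-(1 / 4 : ℝ)) := by
    rw [hr, ← Real.rpow_natCast, ← Real.rpow_mul hTt.le]; norm_num
  calc eLpNorm (u t) 4 volume ^ 2
      ≤ ENNReal.ofReal (W₁ + W₂ * r) ^ 2 := by gcongr; exact hW t ht
    _ = ENNReal.ofReal ((W₁ + W₂ * r) ^ 2) := by
        rw [ENNReal.ofReal_pow (by positivity)]
    _ ≤ ENNReal.ofReal (2 * W₁ ^ 2 + 2 * W₂ ^ 2 * (T - t) ^ (-(1 / 4 : ℝ))) := by
        apply ENNReal.ofReal_le_ofReal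
        rw [← hr2]
        nlinarith [sq_nonneg (W₁ - W₂ * r)]

end LogCubeSharp

end Summit.NavierStokesRegularity.NavierStokesRegularity.Theorems

end
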